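import Literature.Claims.NS.Permana2026
import Summits.NavierStokesRegularity.NavierStokesRegularity.Theorems.SoloSalvageLucardoOlivaes2026GI
import Summits.NavierStokesRegularity.NavierStokesRegularity.Theorems.SoloRefuteLucardoOlivaes2026
import Literature.Analysis.FluidPDE.LeraySelfSimilarCalculus
import HarnessLib

/-!
# C119 `Permana2026` — records-grade companion: the CLASS-UNIFORM depletion constant is kernel-false

Cell `ns-claims`, row C119 (ADJUDICATED #126: first failing step `Literature.Claims.NS.Permana2026.Step_3`
= Lemma 3.1 (7) p.3 l.33–40, class unfilled gap). This file refutes the RECORDS-GRADE FACE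
`Literature.Claims.NS.Permana2026.Step_3cls` (skeleton rev 4/5, typist-11 g6): the depletion constant the
printed PROOF of Lemma 3.1 produces (p.3 l.74–78: «bounded by the uniformly finite L²-energy … Optimizing
δ ≈ |ω|^{−1/4} establishes (7)») depends on `ν` and the energy bound only. That face is false in the class:
along the ENERGY-PRESERVING homothety `v_μ(x) = μ⁶ U(μ⁴ x)` of one fixed datum `U` (the tree's C137
two-blob datum `…Theorems.LucardoOlivaes2026GI.U`, which has a point of positive vortex stretching because
`0 < ∫⟪ω, ∇U ω⟫`), the energy `‖v_μ‖²_{L²} = ‖U‖²_{L²}` is fixed while at `t = 0`, `x = μ⁻⁴x₀`,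
`|⟪ω, ∇u ω⟫| = μ³⁰·⟪ω,∇Uω⟫(x₀)` and `C‖ω‖^{3/2} = C·μ¹⁵·‖ω(x₀)‖^{3/2}` — so no `C = C(ν, E₀)` serves
(repair-census row R3 of `claims/Permana2026/SALVAGE.md`, ref-3 g5 09:49:04Z (ii)). It does NOT touch the
token `Step_3` (per-datum constant `C_{ν,u₀}`), which absorbs every such scaling: `Step_3cls → Step_3`
(`step_3_of_step_3cls`) is the only relation, and a kill of the antecedent says nothing about the consequent.

Main declaration: `not_Step_3cls : ¬ Literature.Claims.NS.Permana2026.Step_3cls`.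
Ingredients (all tree theorems): local existence in the class from every datum
(`…Theorems.LucardoOlivaes2026.exists_isLocalSolution`, Majda–Bertozzi Thm 3.4), energy decay
(`Chae2007.step_3_holds`), the datum `U` with `0 < stretchI U` (`isOuroDatum_U`, `isAlignedDatumI_U`),
dilation calculus (`fderiv_const_smul_comp_smul'`, `norm_iteratedFDeriv_comp_smul`, Mathlib `Measure.map_addHaar_smul`).

WHAT THIS IS NOT: not a claim about NS regularity or blow-up; not a claim about any author beyond the
typed locator.
-/

set_option linter.dupNamespace false

noncomputable section

open Set Function Filter MeasureTheory
open scoped Topology ENNReal NNReal ContDiff RealInnerProductSpace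

namespace Summit.NavierStokesRegularity.NavierStokesRegularity.Theorems.Permana2026

open Literature.Analysis.FluidPDE
open Literature.Claims.NS.Chae2007 (IsDatum IsLocalSolution l2Norm step_3_holds)
open Literature.Claims.NS.LucardoOlivaes2026 (stretchI IsOuroDatum IsAlignedDatumI)
open Literature.Claims.NS.Permana2026 (Step_3cls Step_3 step_3_of_step_3cls)
open Summit.NavierStokesRegularity.NavierStokesRegularity.Theorems.LucardoOlivaes2026GI (U isOuroDatum_U
  isAlignedDatumI_U)
open Summit.NavierStokesRegularity.NavierStokesRegularity.Theorems.LucardoOlivaes2026 (exists_isLocalSolution)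

/-- Physical space `ℝ³`. [folklore] -/
abbrev E3 : Type := EuclideanSpace ℝ (Fin 3)

/-- Change of variables `x ↦ c x` (`c > 0`) in a Lebesgue integral over `ℝ³`: `∫⁻ f(c x) dx = c⁻³ ∫⁻ f`
(Mathlib `Measure.map_addHaar_smul`; same computation as the tree's `lintegral_comp_smul_three`). [folklore] -/
theorem lintegral_comp_smul_E3 (f : E3 → ℝ≥0∞) {c : ℝ} (hc : 0 < c) :
    ∫⁻ x, f (c • x) = ENNReal.ofReal ((c ^ 3)⁻¹) * ∫⁻ x, f x := by
  have hc0 : c ≠ 0 := hc.ne'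
  let e : E3 ≃ᵐ E3 := (Homeomorph.smul (isUnit_iff_ne_zero.2 hc0).unit).toMeasurableEquiv
  have he : (e : E3 → E3) = fun x => c • x := rfl
  calc ∫⁻ x, f (c • x) = ∫⁻ y, f y ∂(Measure.map (fun x => c • x) volume) := by
        rw [← he, lintegral_map_equiv]; rfl
    _ = ENNReal.ofReal ((c ^ 3)⁻¹) * ∫⁻ x, f x := by
        rw [Measure.map_addHaar_smul volume hc0, lintegral_smul_measure,
          finrank_euclideanSpace_fin, abs_of_nonneg (by positivity), smul_eq_mul]

/-! ## The homothety `x ↦ a • v (c • x)` -/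

/-- The two-parameter dilation `(dil a c v)(x) = a • v(c • x)` (amplitude `a`, inverse length `c`);
`a = c^{3/2}` preserves the `L²` norm on `ℝ³`. [folklore] -/
def dil (a c : ℝ) (v : E3 → E3) : E3 → E3 := fun x => a • v (c • x)

/-- `D(dil a c v)(x) = (a c) • Dv(c x)`. [folklore] -/
theorem fderiv_dil (a c : ℝ) (v : E3 → E3) (x : E3) :
    fderiv ℝ (dil a c v) x = (a * c) • fderiv ℝ v (c • x) :=
  fderiv_const_smul_comp_smul' v a c x

/-- `curl(dil a c v)(x) = (a c) • (curl v)(c x)`. [folklore] -/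
theorem curl_dil (a c : ℝ) (v : E3 → E3) (x : E3) :
    curl (dil a c v) x = (a * c) • curl v (c • x) := by
  rw [curl_eq_curlCLM, curl_eq_curlCLM, fderiv_dil, map_smul]

/-- The pointwise vortex-stretching density scales by `(a c)³`:
`⟪ω_λ, ∇v_λ ω_λ⟫(x) = (a c)³ ⟪ω, ∇v ω⟫(c x)`. [folklore] -/
theorem inner_stretch_dil (a c : ℝ) (v : E3 → E3) (x : E3) :
    ⟪curl (dil a c v) x, fderiv ℝ (dil a c v) x (curl (dil a c v) x)⟫ =
      (a * c) ^ 3 * ⟪curl v (c • x), fderiv ℝ v (c • x) (curl v (c • x))⟫ := by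
  rw [curl_dil, fderiv_dil, smul_apply, map_smul, real_inner_smul_left,
    real_inner_smul_right, real_inner_smul_right]
  ring

/-- Dilation preserves smoothness. [folklore] -/
theorem contDiff_dil {v : E3 → E3} (hv : ContDiff ℝ ∞ v) (a c : ℝ) : ContDiff ℝ ∞ (dil a c v) :=
  (hv.comp (contDiff_const_smul c)).const_smul a

/-- Dilation preserves incompressibility. [folklore] -/
theorem isDivFree_dil {v : E3 → E3} (hv : VectorCalculus.IsDivFree v) (a c : ℝ) :
    VectorCalculus.IsDivFree (dil a c v) := fun x => by
  have h := hv (c • x)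
  simp only [VectorCalculus.divergence] at h ⊢
  rw [fderiv_dil, ContinuousLinearMap.toLinearMap_smul, map_smul, h, smul_zero]

/-- `∫ ‖Dⁿ(dil a c v)‖² = (|a| |c|ⁿ)² c⁻³ ∫ ‖Dⁿv‖²` (lower Lebesgue integrals, `c > 0`). [folklore] -/
theorem lintegral_iteratedFDeriv_dil {v : E3 → E3} (hv : ContDiff ℝ ∞ v) (a : ℝ) {c : ℝ} (hc : 0 < c)
    (n : ℕ) :
    ∫⁻ x, ‖iteratedFDeriv ℝ n (dil a c v) x‖ₑ ^ 2 =
      ENNReal.ofReal ((|a| * |c| ^ n) ^ 2 * (c ^ 3)⁻¹) * ∫⁻ x, ‖iteratedFDeriv ℝ n v x‖ₑ ^ 2 := by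
  have hvc : ContDiff ℝ ∞ (fun y => v (c • y)) := hv.comp (contDiff_const_smul c)
  have hpt : ∀ x, ‖iteratedFDeriv ℝ n (dil a c v) x‖ = |a| * |c| ^ n * ‖iteratedFDeriv ℝ n v (c • x)‖ := by
    intro x
    have h1 : iteratedFDeriv ℝ n (dil a c v) x = a • iteratedFDeriv ℝ n (fun y => v (c • y)) x := by
      unfold dil
      exact iteratedFDeriv_const_smul_apply' ((hvc.of_le (by exact_mod_cast le_top)).contDiffAt)
    rw [h1, norm_smul, Real.norm_eq_abs, norm_iteratedFDeriv_comp_smul hv c x (by exact_mod_cast le_top)]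
    ring
  have hpt' : ∀ x, ‖iteratedFDeriv ℝ n (dil a c v) x‖ₑ ^ 2 =
      ENNReal.ofReal ((|a| * |c| ^ n) ^ 2) * ‖iteratedFDeriv ℝ n v (c • x)‖ₑ ^ 2 := by
    intro x
    rw [← ofReal_norm, ← ofReal_norm, hpt, ← ENNReal.ofReal_pow (by positivity),
      ← ENNReal.ofReal_pow (norm_nonneg _), mul_pow, ENNReal.ofReal_mul (by positivity)]
  simp_rw [hpt']
  rw [lintegral_const_mul' _ _ ENNReal.ofReal_ne_top,
    lintegral_comp_smul_E3 (fun x => ‖iteratedFDeriv ℝ n v x‖ₑ ^ 2) hc, ← mul_assoc,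
    ← ENNReal.ofReal_mul (by positivity)]

/-- `∫ ‖dil a c v‖² = a² c⁻³ ∫ ‖v‖²`. [folklore] -/
theorem lintegral_sq_dil {v : E3 → E3} (hv : ContDiff ℝ ∞ v) (a : ℝ) {c : ℝ} (hc : 0 < c) :
    ∫⁻ x, ‖dil a c v x‖ₑ ^ 2 = ENNReal.ofReal (a ^ 2 * (c ^ 3)⁻¹) * ∫⁻ x, ‖v x‖ₑ ^ 2 := by
  have h := lintegral_iteratedFDeriv_dil hv a hc 0
  have e1 : (fun x => ‖iteratedFDeriv ℝ 0 (dil a c v) x‖ₑ ^ 2) = fun x => ‖dil a c v x‖ₑ ^ 2 := by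
    funext x; rw [← ofReal_norm, norm_iteratedFDeriv_zero, ofReal_norm]
  have e2 : (fun x => ‖iteratedFDeriv ℝ 0 v x‖ₑ ^ 2) = fun x => ‖v x‖ₑ ^ 2 := by
    funext x; rw [← ofReal_norm, norm_iteratedFDeriv_zero, ofReal_norm]
  rw [e1, e2, pow_zero, mul_one, sq_abs] at h
  exact h

/-- The dilate of a datum of the class is a datum of the class. [folklore] -/
theorem isDatum_dil {v : E3 → E3} (hv : IsDatum v) (a : ℝ) {c : ℝ} (hc : 0 < c) :
    IsDatum (dil a c v) := by
  obtain ⟨hsm, hdiv, hH⟩ := hv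
  refine ⟨contDiff_dil hsm a c, isDivFree_dil hdiv a c, fun n => ?_⟩
  rw [lintegral_iteratedFDeriv_dil hsm a hc n]
  exact ENNReal.mul_lt_top ENNReal.ofReal_lt_top (hH n)

/-- The `L²`-preserving choice `a = μ⁶`, `c = μ⁴`: `‖dil μ⁶ μ⁴ v‖_{L²} = ‖v‖_{L²}`. [folklore] -/
theorem l2Norm_dil_eq {v : E3 → E3} (hv : ContDiff ℝ ∞ v) {μ : ℝ} (hμ : 0 < μ) :
    l2Norm (dil (μ ^ 6) (μ ^ 4) v) = l2Norm v := by
  unfold l2Norm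
  rw [lintegral_sq_dil hv _ (by positivity : (0:ℝ) < μ ^ 4)]
  have : (μ ^ 6) ^ 2 * ((μ ^ 4) ^ 3)⁻¹ = 1 := by
    rw [← pow_mul, ← pow_mul, mul_inv_cancel₀ (pow_ne_zero _ hμ.ne')]
  rw [this, ENNReal.ofReal_one, one_mul]

/-! ## The kill -/

/-- **`Step_3cls` is false**: the class-uniform depletion constant `C(ν, E₀)` of the printed proof of
Lemma 3.1 (p.3 l.74–78) cannot exist — at `ν = 1`, `E₀ = ‖U‖²_{L²}` (the C137 two-blob datum), the
energy-preserving dilates `v_μ = μ⁶U(μ⁴·)` violate `|⟪ω, ∇u ω⟫| ≤ C‖ω‖^{3/2}` at `t = 0` for `μ` large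
(`μ³⁰` against `μ¹⁵`). Records-grade companion to #126 (repair-census row R3); the token `Step_3` is
untouched. [cite: Permana2026, Lemma 3.1 (7) p.3 l.33–40, proof p.3 l.74–78] -/
theorem not_Step_3cls : ¬ Step_3cls := by
  intro h
  -- the datum and a point of positive stretching
  have hUdat : IsDatum U := isOuroDatum_U.1
  have hpos : 0 < stretchI U := isAlignedDatumI_U
  obtain ⟨x₀, hx₀⟩ : ∃ x₀ : E3, 0 < ⟪curl U x₀, fderiv ℝ U x₀ (curl U x₀)⟫ := by
    by_contra hne
    push Not at hne
    have hle : stretchI U ≤ 0 := by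
      unfold stretchI
      exact integral_nonpos fun x => hne x
    exact absurd hpos (not_lt.2 hle)
  set a₀ : ℝ := ⟪curl U x₀, fderiv ℝ U x₀ (curl U x₀)⟫ with ha₀
  set b₀ : ℝ := ‖curl U x₀‖ ^ ((3:ℝ) / 2) with hb₀
  have hb₀0 : 0 ≤ b₀ := by positivity
  -- the class-uniform constant at `ν = 1`, `E₀ = ‖U‖²`
  obtain ⟨C, hC, hlaw⟩ := h 1 one_pos (l2Norm U ^ 2) (sq_nonneg _)
  -- the scale
  set μ : ℝ := 2 + C * b₀ / a₀ with hμ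
  have hq : 0 ≤ C * b₀ / a₀ := by positivity
  have hμ1 : 1 ≤ μ := by linarith
  have hμ0 : 0 < μ := by linarith
  have hc : (0:ℝ) < μ ^ 4 := by positivity
  -- the dilated datum and a class solution from it
  have hvdat : IsDatum (dil (μ ^ 6) (μ ^ 4) U) := isDatum_dil hUdat _ hc
  obtain ⟨T, hT, u, p, hsol⟩ := exists_isLocalSolution zero_le_one hvdat
  -- the energy hypothesis along the flow (energy decay; the dilation preserves `‖·‖_{L²}`)
  have hE : ∀ t ∈ Ico 0 T, l2Norm (u t) ^ 2 ≤ l2Norm U ^ 2 := by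
    intro t ht
    have h1 : l2Norm (u t) ≤ l2Norm (dil (μ ^ 6) (μ ^ 4) U) :=
      step_3_holds 1 zero_le_one T hT _ u p hsol t ht
    rw [l2Norm_dil_eq hUdat.1 hμ0] at h1
    have h0 : 0 ≤ l2Norm (u t) := Real.sqrt_nonneg _
    exact pow_le_pow_left₀ h0 h1 2
  -- the law at `t = 0`, `x = μ⁻⁴ x₀`
  have key := hlaw T hT _ u p hsol hE 0 ⟨le_rfl, hT⟩ ((μ ^ 4)⁻¹ • x₀)
  rw [hsol.initial] at key
  have hcx : (μ ^ 4) • ((μ ^ 4)⁻¹ • x₀) = x₀ := by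
    rw [smul_smul, mul_inv_cancel₀ hc.ne', one_smul]
  have hac : μ ^ 6 * μ ^ 4 = μ ^ 10 := by ring
  have hL : ⟪curl (dil (μ ^ 6) (μ ^ 4) U) ((μ ^ 4)⁻¹ • x₀),
      fderiv ℝ (dil (μ ^ 6) (μ ^ 4) U) ((μ ^ 4)⁻¹ • x₀) (curl (dil (μ ^ 6) (μ ^ 4) U) ((μ ^ 4)⁻¹ • x₀))⟫
        = μ ^ 30 * a₀ := by
    rw [inner_stretch_dil, hcx, hac, ← ha₀]; ring
  have hR : ‖curl (dil (μ ^ 6) (μ ^ 4) U) ((μ ^ 4)⁻¹ • x₀)‖ ^ ((3:ℝ) / 2) = μ ^ 15 * b₀ := by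
    rw [curl_dil, hcx, hac, norm_smul, Real.norm_eq_abs, abs_of_pos (by positivity),
      Real.mul_rpow (by positivity) (norm_nonneg _), ← hb₀]
    congr 1
    rw [← Real.rpow_natCast μ 10, ← Real.rpow_mul hμ0.le,
      show ((10:ℕ):ℝ) * ((3:ℝ) / 2) = ((15:ℕ):ℝ) by norm_num, Real.rpow_natCast]
  rw [hL, hR, abs_of_pos (by positivity)] at key
  -- key : μ ^ 30 * a₀ ≤ C * (μ ^ 15 * b₀); but μ ^ 15 * a₀ ≥ μ * a₀ = 2 a₀ + C b₀ > C b₀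
  have h15 : (0:ℝ) < μ ^ 15 := by positivity
  have hμ15 : μ ≤ μ ^ 15 := le_self_pow₀ hμ1 (by norm_num)
  have hμa : μ * a₀ = 2 * a₀ + C * b₀ := by
    rw [hμ]; field_simp
  have hA : C * b₀ < μ ^ 15 * a₀ := by
    have := mul_le_mul_of_nonneg_right hμ15 hx₀.le
    linarith
  have h30 : μ ^ 30 * a₀ = μ ^ 15 * (μ ^ 15 * a₀) := by ring
  rw [h30] at key
  nlinarith [mul_lt_mul_of_pos_left hA h15]

/-- FQN guard: the refuted face is the Literature decl of record. [cite: Permana2026, p.3 l.74–78] -/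
example : ¬ Literature.Claims.NS.Permana2026.Step_3cls := not_Step_3cls

end Summit.NavierStokesRegularity.NavierStokesRegularity.Theorems.Permana2026

end
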